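import Summits.Ventures.WeilGRH.UniformConductorFloorLog12Primes
import Summits.Ventures.WeilGRH.UniformConductorFloorPrincipalMod281Log12
import Summits.Ventures.WeilGRH.UniformConductorFloorPrincipalMod283Log12
import HarnessLib

/-!
# GRH arm (rh-explicit, venture WeilGRH): ★★★ RUNG SIX `(log 12)/2` FOR PRIME MODULI, COMPLETE — `U_{(log 12)/2}(p) ↔ p ≥ 281` (277 and 281 both sharp)

Cell `rh-explicit`, WEIL TRACK — GRH ARM (weil-grh-1 gen10).  `UniformConductorFloorLog12Primes.lean` (gen9) decides the sixth rung of the principal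
dichotomy for every prime `p ∉ {281, 283}`: `p ≤ 277` fails (flat window for `p ≤ 271`; a table-based 40-mode Galerkin witness for the razor `277`),
`p ≥ 293` holds (door cell `293`, uniform joint-cell floor `296`).  The two door-E cells of gen10 close the exceptions: `χ₀` mod `283` on the 128-mode
table (`UniformConductorFloorPrincipalMod283Log12.lean`, blocks `10 × 127 ∣ 16 × 40`, `θ = 3/64`, kernel margins `0.0010 ∣ 2.19`) and `χ₀` mod `281` on the
256-mode table `Log12Table.tab256` (`UniformConductorFloorPrincipalMod281Log12.lean`, blocks `14 × 255 ∣ 16 × 40`, `θ = 2/64`, margins `0.00125 ∣ 2.19` — with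
far block `B₃ ≤ 200` the door is not positive definite for `281`).  RESULT: for a prime `p`, every Dirichlet character mod `p` is Weil-positive on
`[-(log 12)/2, (log 12)/2]` iff `p ≥ 281`; BOTH neighbours of the threshold are razors decided by many-mode objects (`277` FALSE by 40 modes at margin
`≈ 3·10⁻⁴`, `281` TRUE at door margin `0.00125`).  The prime-threshold ladder of the all-characters statement now reads
`p*(t) = 79, 97, 127, 173, 223, 281` at `t = 1, (log 8)/2, log 3, (log 10)/2, (log 11)/2, (log 12)/2` — every rung exact
(`log p* ≈ −0.85 + 5.2 t`); the window-monotone form for `p ≤ 277`, `t ≥ (log 12)/2` is `exists_not_weilPositivityOnChar_of_log12half_le_of_prime_le_277` of `UniformConductorFloorLog12Primes.lean`.  RH/GRH-free; standard axioms; no definitions; no named facts.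

## References

* A. Weil (1952), (11) pp. 261–262 and the «lemme» p. 262 [Weil1952FormulesExplicites]; H. Yoshida (1992) §§5–7 [Yoshida1992HermitianForms].
-/

noncomputable section

namespace Summit.Ventures.WeilGRH

open Literature.NumberTheory.LFunctions

namespace UniformFloor

variable {q : ℕ}

/-- ★★ `U_{(log 12)/2}(281)`: every Dirichlet character mod `281` is Weil-positive on `[−(log 12)/2, (log 12)/2]` (principal door cell on the 256-mode table,
even margin `0.00125`). [cite: Weil1952FormulesExplicites, (11) pp. 261–262] -/
theorem forall_weilPositivityOnChar_log12half_mod_twoEightyOne (χ : DirichletCharacter ℂ 281) :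
    WeilPositivityOnChar χ (Real.log 12 / 2) := by
  have ha : (0 : ℝ) < Real.log 12 / 2 := by
    have : (1 : ℝ) < 12 := by norm_num
    positivity
  exact WeilPositivityOnChar.of_principal (by norm_num) ha
    PrincipalMod281Log12.weilPositivityOnChar_log12half_principal_mod_twoEightyOne χ

/-- ★★ `U_{(log 12)/2}(283)`: every Dirichlet character mod `283` is Weil-positive on `[−(log 12)/2, (log 12)/2]` (principal door cell, even margin `0.0010`).
[cite: Weil1952FormulesExplicites, (11) pp. 261–262] -/
theorem forall_weilPositivityOnChar_log12half_mod_twoEightyThree (χ : DirichletCharacter ℂ 283) :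
    WeilPositivityOnChar χ (Real.log 12 / 2) := by
  have ha : (0 : ℝ) < Real.log 12 / 2 := by
    have : (1 : ℝ) < 12 := by norm_num
    positivity
  exact WeilPositivityOnChar.of_principal (by norm_num) ha
    PrincipalMod283Log12.weilPositivityOnChar_log12half_principal_mod_twoEightyThree χ

/-- ★ Every character of every PRIME modulus `p ≥ 281` is Weil-positive on `[-(log 12)/2, (log 12)/2]` (cells `281`, `283`, `293`; uniform floor from `296`).
[cite: Weil1952FormulesExplicites, (11) pp. 261–262 and the «lemme» p. 262] -/
theorem forall_weilPositivityOnChar_log12half_of_prime_ge_281 (hp : q.Prime) (hq : 281 ≤ q) (χ : DirichletCharacter ℂ q) :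
    WeilPositivityOnChar χ (Real.log 12 / 2) := by
  by_cases h293 : 293 ≤ q
  · exact forall_weilPositivityOnChar_log12half_of_prime_ge_293 hp h293 χ
  · have h292 : q ≤ 292 := by omega
    interval_cases q
    · exact forall_weilPositivityOnChar_log12half_mod_twoEightyOne χ
    all_goals first | exact forall_weilPositivityOnChar_log12half_mod_twoEightyThree χ | exact absurd hp (by norm_num)

/-- ★★★ **RUNG SIX FOR PRIMES, COMPLETE**: for a prime `p`, every Dirichlet character mod `p` is Weil-positive on `[-(log 12)/2, (log 12)/2]` iff `p ≥ 281`
(`277` and `281` both sharp). [cite: Weil1952FormulesExplicites, (11) pp. 261–262 and the «lemme» p. 262] -/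
theorem forall_weilPositivityOnChar_log12half_iff_of_prime_complete (hp : q.Prime) :
    (∀ χ : DirichletCharacter ℂ q, WeilPositivityOnChar χ (Real.log 12 / 2)) ↔ 281 ≤ q := by
  constructor
  · intro h
    by_contra hlt
    have h277 : q ≤ 277 := by
      by_contra h'
      have h278 : 278 ≤ q := by omega
      have h280 : q ≤ 280 := by omega
      interval_cases q
      all_goals exact absurd hp (by norm_num)
    exact not_weilPositivityOnChar_log12half_principal_of_prime_le_277 hp h277 (h 1)
  · intro hq χ
    exact forall_weilPositivityOnChar_log12half_of_prime_ge_281 hp hq χ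

/-- For a prime `p`, some character mod `p` fails on `[-(log 12)/2, (log 12)/2]` iff `p ≤ 277`. [cite: Weil1952FormulesExplicites, (11) pp. 261–262] -/
theorem exists_not_weilPositivityOnChar_log12half_iff_of_prime_complete (hp : q.Prime) :
    (∃ χ : DirichletCharacter ℂ q, ¬ WeilPositivityOnChar χ (Real.log 12 / 2)) ↔ q ≤ 277 := by
  rw [← not_iff_not]
  push Not
  rw [forall_weilPositivityOnChar_log12half_iff_of_prime_complete hp]
  constructor
  · intro h; omega
  · intro h
    by_contra h'
    have h278 : 278 ≤ q := by omega
    have h280 : q ≤ 280 := by omega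
    interval_cases q
    all_goals exact absurd hp (by norm_num)

end UniformFloor

end Summit.Ventures.WeilGRH

end
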